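import Literature.NumberTheory.Automorphic.AutomorphicInductionUnitaryCharacterCubicGaloisProofs
import Literature.NumberTheory.Automorphic.RamakrishnanMultiplicityOneDihedral
import HarnessLib

/-!
# Non-normal cubic automorphic induction of a Hecke character: the resolvent tower and the
# sign-blind descent (proofs)

Topic `NumberTheory/Automorphic`; namespace `Literature.NumberTheory.Automorphic`.  A proof file
(theorems only: no definition, no named fact, no instance) attached to the named fact
`Literature.NumberTheory.Automorphic.automorphicInduction_unitaryCharacter_cubic`
(`AutomorphicInductionUnitaryCharacterCubic`: Jacquet–Piatetski-Shapiro–Shalika 1979, §§13–14, as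
restated in Gelbart 1997, Thm. 5.3.1 with Remark 5.3.1 (e) — automorphic induction of a Hecke
character `θ` of an ARBITRARY cubic extension `E/F` to `GL₃(𝔸_F)`), continuing
`AutomorphicInductionUnitaryCharacterCubicGaloisProofs` (the Galois case from Arthur–Clozel).

For `E/F` cubic and NOT normal, let `L` be its Galois closure (`Gal(L/F) ≅ S₃`) and `K ⊆ L` the
quadratic resolvent, so that `L/K` is cyclic cubic, `L/E` and `K/F` are quadratic, and
`Gal(L/F) = Gal(L/E) · Gal(L/K)`.  The cyclic theory of Arthur–Clozel (Ann. of Math. Stud. 120,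
Ch. 3: base change for `GL(1)` along `L/E`, automorphic induction along `L/K`, Thm. 6.2 with
Lemma 6.4, and descent along `K/F`, Thm. 4.2 (d)) produces from `θ` the cuspidal representation
`P = AI_{L/K}(θ ∘ N_{L/E})` of `GL₃(𝔸_K)` and a cuspidal `π` on `GL₃(𝔸_F)` with
`BC_{K/F}(π) = P` in the weak sense.  This file formalises that construction on the tree's
Borel–Jacquet data, granting the two named facts `automorphicInduction_cyclic_cuspidal` and
`cuspidal_descent_cyclic`, and proves what it yields towards the fact:

* **Group theory of the sextic diagram** (`F ⊆ K ⊆ L`, `F ⊆ E ⊆ L`, `[L:K] = 3`, `[L:E] = 2`,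
  `L/F` Galois of degree `6`; no hypothesis distinguishing `S₃` from `C₆` is needed here):
  `algEquiv_eq_one_of_restrictScalars_eq` (`Gal(L/K) ∩ Gal(L/E) = 1`),
  `exists_eq_restrictScalars_mul_restrictScalars` (`Gal(L/F) = Gal(L/E) · Gal(L/K)`).
* **Decomposition groups at unramified places** (Mathlib's `Ideal.card_stabilizer_eq` on the
  tree's action on `HeightOneSpectrum`): `HeightOneSpectrum.card_stabilizer_eq_inertiaDeg`
  (`#D_W = f(W|v)`), `inertiaDeg_dvd_finrank`, `smul_eq_self_of_card_stabilizer_eq`, and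
  `inertiaDeg_ne_finrank_of_mul_ne` (for NON-abelian `Gal(L/F)` no unramified place has
  `f(W|v) = [L:F]`: `D_W` embeds into the cyclic automorphism group of the residue extension).
* **Places above a place `v` of `F` inert in `K`, `S₃` case** (`Gal(L/F)` non-abelian):
  `HeightOneSpectrum.inertiaDeg_of_resolventInert` — `f(W|V) = 1`, `f(W|v) = 2`, and `W ∩ E` is a
  degree-`1` place of `E` inert in `L` or a degree-`2` place split in `L` (splitting type `(1,2)`).
* **Places above a place `v` of `F` split in `K`** (`f(V|v) = 1`):
  `HeightOneSpectrum.inertiaDeg_of_resolventSplit` (`f(W | W ∩ E) = 1`, `f(W|V) = f(W ∩ E | v)`: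
  `f(W|V) ∣ 3`, `f(W | W ∩ E) ∣ 2`), `HeightOneSpectrum.placesOver_resolventSplit` (`W ↦ W ∩ E`
  is a bijection from the places of `L` above `V` onto the places of `E` above `v`), hence
  `finprod_resolventSplit_eq`: **the induced local factor of `θ_L = θ ∘ N_{L/E}` along `L/K` at
  `V` is the induced local factor `∏_{w ∣ v} (X^{f(w|v)} - θ(ϖ_w))` of `θ` along `E/F` at `v`**;
  and `finprod_eq_finprod_of_under_eq`: the factor is the same at both places of `K` above a
  split `v`, while above an inert `v` there is a single place — the `Gal(K/F)`-stability of `P`.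
* `exists_cuspidal_resolventDescent` — **the descent**: cuspidal `P` on `GL₃(𝔸_K)` with
  `det(X - t_{P,V}) = ∏_{W ∣ V} (X^{f(W|V)} - θ_L(ϖ_W))` a.e. and cuspidal `π` on `GL₃(𝔸_F)`
  with `t_{P,V} = t_{π,v}^{f(V|v)}` a.e. (`IsWeakBaseChangeLiftAE π P`), for `θ_L` not
  `Gal(L/K)`-stable at infinitely many places.
* `exists_cuspidal_cubic_resolventSplit` — **the local identity of the fact at almost every place
  of `F` split in `K`**: `det(X - t_{π,v}) = ∏_{w ∣ v} (X^{f(w|v)} - θ(ϖ_w))`;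
  `exists_cuspidal_cubic_resolvent` — the same `π` at every unramified `v`: the identity at split
  `v`, and at inert `v` the SQUARES `det(X - t_{π,v}²) = ∏_{W ∣ V} (X^{f(W|V)} - θ(ϖ_{W∩E})^{f(W|W∩E)})`
  (the precise residue of the sign ambiguity, see below);
  `frequently_baseChange_valueAtUniformizer_ne`, `exists_cuspidal_cubic_resolventSplit_of_frequently`
  — the non-stability hypothesis on `θ ∘ N_{L/E}` from a hypothesis on `θ` (infinitely many `v`
  split in `K` with two places of `E` above `v` carrying different values of `θ`).

What is NOT proved, and why (the content proper of the fact).  At a place `v` of `F` inert in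
`K` (Frobenius a transposition of `S₃`; `v = w₁ w₂` in `E` with `f = 1, 2`) the relation
`t_{P,V} = t_{π,v}²` determines `t_{π,v}` only up to signs: with `a = θ(ϖ_{w₁})`,
`c = θ(ϖ_{w₂})`, `t_{P,V} = {a², c, c}`, and `{a, √c, -√c}` (the induced datum), `{-a, √c, √c}`,
`{-a, -√c, -√c}` all have the same square and the same determinant.  The ambiguity is intrinsic to
every construction through `K`: for the unramified quadratic extension `K_V/F_v`, the unramified
principal series of `GL₃(F_v)` with parameters `{a, b, -b}` and `{-a, b, b}` have the same
Shintani lift (their characters are supported on split tori, on whose norms — elements with even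
valuations — they agree), so even full local base change cannot separate them.  Pinning the sign
is the non-normal cubic lifting of Jacquet–Piatetski-Shapiro–Shalika (the converse theorem for
`GL(3)`, op. cit. §§13–14; Gelbart 1997, Remark 5.3.1 (e)), which has no carrier in the tree (no
local representation theory of `GL₃(F_v)` at ramified places, no Whittaker models, no converse
theorem for any `GL_n`, `n ≥ 2`).  Net debt unchanged.

## References

* J. Arthur, L. Clozel, *Simple algebras, base change, and the advanced theory of the trace
  formula*, Ann. of Math. Stud. 120 (1989), Ch. 3, §1 Def. 1.1, Thm. 4.2 (d), Def. 6.1,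
  Thm. 6.2, Lemma 6.4. [ArthurClozelAMS120]
* S. Gelbart, *Three lectures on the modularity of `ρ̄_{E,3}` and the Langlands reciprocity
  conjecture* (1997), Thm. 5.3.1, Remarks 5.3.1 (a), (e). [Gelbart1997]
* H. Jacquet, I. I. Piatetski-Shapiro, J. Shalika, *Automorphic forms on GL(3) II*, Ann. of Math.
  109 (1979), §§13–14. [JacquetPiatetskishapiroShalika1979II]
* J. W. S. Cassels, A. Fröhlich (eds.), *Algebraic Number Theory* (1967), Ch. VII (Tate), §1.1
  and Prop. 1.2 (ii) (conjugate places, transitivity). [CasselsFrohlichANT1967]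
* J. Neukirch, *Algebraic Number Theory* (1999), Ch. I §9, (9.2)–(9.6) (decomposition groups,
  `#D_W = e f`). [NeukirchANT1999]
-/

noncomputable section

open scoped NumberField Polynomial Classical Pointwise
open NumberField IsDedekindDomain Polynomial Filter Literature.NumberTheory.Automorphic

namespace Literature.NumberTheory.Automorphic

/-! ### The sextic diagram `F ⊆ K ⊆ L ⊇ E ⊇ F`: Galois groups -/

section Groups

variable {F K L E : Type} [Field F] [Field K] [Field L] [Field E]
  [Algebra F K] [Algebra K L] [Algebra F L] [IsScalarTower F K L]
  [Algebra F E] [Algebra E L] [IsScalarTower F E L]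

omit [Algebra F E] [IsScalarTower F E L] in
/-- `restrictScalars` is multiplicative. [folklore] -/
theorem AlgEquiv.restrictScalars_mul' (a b : L ≃ₐ[K] L) :
    (a * b).restrictScalars F = a.restrictScalars F * b.restrictScalars F :=
  AlgEquiv.ext fun _ => rfl

omit [Algebra F E] [IsScalarTower F E L] in
/-- `restrictScalars` commutes with powers. [folklore] -/
theorem AlgEquiv.restrictScalars_pow' (a : L ≃ₐ[K] L) (n : ℕ) :
    (a ^ n).restrictScalars F = a.restrictScalars F ^ n := by
  induction n with
  | zero => exact AlgEquiv.ext fun _ => rfl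
  | succ n ih => rw [pow_succ, pow_succ, AlgEquiv.restrictScalars_mul', ih]

omit [Algebra F E] [IsScalarTower F E L] in
/-- `restrictScalars` commutes with inverses. [folklore] -/
theorem AlgEquiv.restrictScalars_inv' (a : L ≃ₐ[K] L) :
    (a⁻¹).restrictScalars F = (a.restrictScalars F)⁻¹ := by
  rw [eq_inv_iff_mul_eq_one, ← AlgEquiv.restrictScalars_mul', inv_mul_cancel]
  exact AlgEquiv.ext fun _ => rfl

/-- **`Gal(L/K) ∩ Gal(L/E) = 1` inside `Gal(L/F)` when `[L:K] = 3` and `[L:E] = 2`**: an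
`F`-automorphism of `L` that is both `K`-linear and `E`-linear has order dividing `gcd(3, 2) = 1`.
[folklore] -/
theorem algEquiv_eq_one_of_restrictScalars_eq [FiniteDimensional K L] [FiniteDimensional E L]
    [IsGalois K L] [IsGalois E L]
    (hKL : Module.finrank K L = 3) (hEL : Module.finrank E L = 2)
    {a : L ≃ₐ[K] L} {s : L ≃ₐ[E] L} (h : a.restrictScalars F = s.restrictScalars F) :
    s = 1 ∧ a = 1 := by
  have ha3 : a ^ 3 = 1 := by
    rw [← hKL, ← IsGalois.card_aut_eq_finrank K L]
    exact pow_card_eq_one'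
  have hs2 : s ^ 2 = 1 := by
    rw [← hEL, ← IsGalois.card_aut_eq_finrank E L]
    exact pow_card_eq_one'
  have hg3 : s.restrictScalars F ^ 3 = 1 := by
    rw [← h, ← AlgEquiv.restrictScalars_pow', ha3]
    exact AlgEquiv.ext fun _ => rfl
  have hg2 : s.restrictScalars F ^ 2 = 1 := by
    rw [← AlgEquiv.restrictScalars_pow', hs2]
    exact AlgEquiv.ext fun _ => rfl
  have hg : s.restrictScalars F = 1 := by
    have h1 : s.restrictScalars F ^ Nat.gcd 2 3 = 1 := pow_gcd_eq_one.2 ⟨hg2, hg3⟩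
    rwa [show Nat.gcd 2 3 = 1 by norm_num, pow_one] at h1
  have hs : s = 1 := AlgEquiv.ext fun x => by
    simpa using AlgEquiv.congr_fun hg x
  refine ⟨hs, AlgEquiv.ext fun x => ?_⟩
  have hx := AlgEquiv.congr_fun h x
  rw [hs] at hx
  simpa using hx

/-- **`Gal(L/F) = Gal(L/E) · Gal(L/K)`** for `L/F` Galois of degree `6` with `[L:K] = 3`,
`[L:E] = 2`: every `F`-automorphism of `L` is uniquely `s ∘ a` with `s ∈ Gal(L/E)`,
`a ∈ Gal(L/K)` (the map `(s, a) ↦ s a` is injective by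
`algEquiv_eq_one_of_restrictScalars_eq`, and both sides have `6` elements). [folklore] -/
theorem exists_eq_restrictScalars_mul_restrictScalars [FiniteDimensional F L]
    [FiniteDimensional K L] [FiniteDimensional E L] [IsGalois F L] [IsGalois K L] [IsGalois E L]
    (hFL : Module.finrank F L = 6) (hKL : Module.finrank K L = 3) (hEL : Module.finrank E L = 2)
    (g : L ≃ₐ[F] L) :
    ∃ (s : L ≃ₐ[E] L) (a : L ≃ₐ[K] L), g = s.restrictScalars F * a.restrictScalars F := by
  let φ : (L ≃ₐ[E] L) × (L ≃ₐ[K] L) → (L ≃ₐ[F] L) :=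
    fun p => p.1.restrictScalars F * p.2.restrictScalars F
  have hinj : Function.Injective φ := by
    rintro ⟨s, a⟩ ⟨s', a'⟩ hφ
    have hφ' : s.restrictScalars F * a.restrictScalars F =
        s'.restrictScalars F * a'.restrictScalars F := hφ
    have key' : a.restrictScalars F * (a'.restrictScalars F)⁻¹ =
        (s.restrictScalars F)⁻¹ * s'.restrictScalars F := by
      calc a.restrictScalars F * (a'.restrictScalars F)⁻¹
          = (s.restrictScalars F)⁻¹ * (s.restrictScalars F * a.restrictScalars F) *
              (a'.restrictScalars F)⁻¹ := by group
        _ = (s.restrictScalars F)⁻¹ * (s'.restrictScalars F * a'.restrictScalars F) *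
              (a'.restrictScalars F)⁻¹ := by rw [hφ']
        _ = (s.restrictScalars F)⁻¹ * s'.restrictScalars F := by group
    have key : (a * a'⁻¹).restrictScalars F = (s⁻¹ * s').restrictScalars F := by
      rw [AlgEquiv.restrictScalars_mul', AlgEquiv.restrictScalars_mul',
        AlgEquiv.restrictScalars_inv', AlgEquiv.restrictScalars_inv']
      exact key'
    obtain ⟨h1, h2⟩ := algEquiv_eq_one_of_restrictScalars_eq (F := F) hKL hEL key
    rw [inv_mul_eq_one] at h1
    rw [mul_inv_eq_one] at h2
    rw [h1, h2]
  have hcard : Nat.card (L ≃ₐ[F] L) ≤ Nat.card ((L ≃ₐ[E] L) × (L ≃ₐ[K] L)) := by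
    rw [Nat.card_prod, IsGalois.card_aut_eq_finrank, IsGalois.card_aut_eq_finrank,
      IsGalois.card_aut_eq_finrank, hFL, hKL, hEL]
  obtain ⟨⟨s, a⟩, hsa⟩ := (hinj.bijective_of_nat_card_le hcard).2 g
  exact ⟨s, a, hsa.symm⟩

end Groups

/-! ### Places of a Galois extension: decomposition groups at unramified places -/

section GaloisPlaces

variable {F L : Type} [Field F] [NumberField F] [Field L] [NumberField L] [Algebra F L]

omit [NumberField F] [NumberField L] in
/-- The stabiliser of a finite place `W` of `L` in `Aut(L/F)` is the stabiliser of its prime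
ideal (the decomposition group `D_W`). [folklore] -/
theorem HeightOneSpectrum.stabilizer_eq_stabilizer_asIdeal (W : HeightOneSpectrum (𝓞 L)) :
    MulAction.stabilizer (L ≃ₐ[F] L) W = MulAction.stabilizer (L ≃ₐ[F] L) W.asIdeal :=
  Subgroup.ext fun g => by
    simp only [MulAction.mem_stabilizer_iff, HeightOneSpectrum.ext_iff,
      HeightOneSpectrum.smul_asIdeal]

/-- **`#D_W = f(W|v)` at a place unramified in a Galois extension** (`#D_W = e f`, Mathlib
`Ideal.card_stabilizer_eq`, with `e = 1`). [folklore] -/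
theorem HeightOneSpectrum.card_stabilizer_eq_inertiaDeg [IsGalois F L]
    {v : HeightOneSpectrum (𝓞 F)} {W : HeightOneSpectrum (𝓞 L)}
    (hW : W.asIdeal.under (𝓞 F) = v.asIdeal) (hv : Algebra.IsUnramifiedIn (𝓞 L) v.asIdeal) :
    Nat.card (MulAction.stabilizer (L ≃ₐ[F] L) W) = W.asIdeal.inertiaDeg (𝓞 F) := by
  haveI : Module.Finite (𝓞 F) (𝓞 L) := IsIntegralClosure.finite (𝓞 F) F L (𝓞 L)
  haveI : IsGaloisGroup (L ≃ₐ[F] L) (𝓞 F) (𝓞 L) := IsGaloisGroup.of_isFractionRing _ _ _ F L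
  haveI := W.isPrime
  haveI := v.isPrime
  haveI : W.asIdeal.LiesOver v.asIdeal := ⟨hW.symm⟩
  rw [HeightOneSpectrum.stabilizer_eq_stabilizer_asIdeal W,
    Ideal.card_stabilizer_eq (G := L ≃ₐ[F] L) v.asIdeal W.asIdeal,
    Ideal.ramificationIdxIn_eq_ramificationIdx v.asIdeal W.asIdeal (L ≃ₐ[F] L),
    Ideal.inertiaDegIn_eq_inertiaDeg v.asIdeal W.asIdeal (L ≃ₐ[F] L),
    hv.ramificationIdx_eq_one ⟨hW.symm⟩, one_mul]

/-- **`f(W|v) ∣ [L:F]`** in a Galois extension (the fundamental identity `g e f = [L:F]`, Mathlib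
`Ideal.ncard_primesOver_mul_ramificationIdxIn_mul_inertiaDegIn`). [folklore] -/
theorem HeightOneSpectrum.inertiaDeg_dvd_finrank [IsGalois F L]
    {v : HeightOneSpectrum (𝓞 F)} {W : HeightOneSpectrum (𝓞 L)}
    (hW : W.asIdeal.under (𝓞 F) = v.asIdeal) :
    W.asIdeal.inertiaDeg (𝓞 F) ∣ Module.finrank F L := by
  haveI : Module.Finite (𝓞 F) (𝓞 L) := IsIntegralClosure.finite (𝓞 F) F L (𝓞 L)
  haveI : IsGaloisGroup (L ≃ₐ[F] L) (𝓞 F) (𝓞 L) := IsGaloisGroup.of_isFractionRing _ _ _ F L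
  haveI := W.isPrime
  haveI := v.isPrime
  haveI : W.asIdeal.LiesOver v.asIdeal := ⟨hW.symm⟩
  have h := Ideal.ncard_primesOver_mul_ramificationIdxIn_mul_inertiaDegIn v.asIdeal (𝓞 L)
    (L ≃ₐ[F] L)
  rw [IsGalois.card_aut_eq_finrank,
    Ideal.inertiaDegIn_eq_inertiaDeg v.asIdeal W.asIdeal (L ≃ₐ[F] L)] at h
  exact ⟨(v.asIdeal.primesOver (𝓞 L)).ncard * v.asIdeal.ramificationIdxIn (𝓞 L),
    by rw [← h]; ring⟩

/-- If `#D_W = [L:F]` then `W` is the only place above `v`: every `F`-automorphism fixes `W`.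
[folklore] -/
theorem HeightOneSpectrum.smul_eq_self_of_card_stabilizer_eq [IsGalois F L]
    {W : HeightOneSpectrum (𝓞 L)}
    (h : Nat.card (MulAction.stabilizer (L ≃ₐ[F] L) W) = Module.finrank F L) (g : L ≃ₐ[F] L) :
    g • W = W := by
  have htop : MulAction.stabilizer (L ≃ₐ[F] L) W = ⊤ :=
    Subgroup.eq_top_of_card_eq _ (by rw [h, IsGalois.card_aut_eq_finrank])
  exact (Subgroup.eq_top_iff' _).1 htop g

/-- **At a place unramified in a Galois extension with NON-abelian group, no place has full
residue degree `[L:F]`**: otherwise its decomposition group is all of `Gal(L/F)`, which embeds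
(inertia being trivial, Mathlib `Ideal.Quotient.ker_stabilizerHom`,
`Ideal.card_inertia_eq_ramificationIdxIn`) into the automorphism group of the residue field
extension, a cyclic group (Mathlib's `IsCyclic Gal(l/k)` for finite fields). [folklore] -/
theorem HeightOneSpectrum.inertiaDeg_ne_finrank_of_mul_ne [IsGalois F L]
    (hG : ∃ g h : L ≃ₐ[F] L, g * h ≠ h * g)
    {v : HeightOneSpectrum (𝓞 F)} {W : HeightOneSpectrum (𝓞 L)}
    (hW : W.asIdeal.under (𝓞 F) = v.asIdeal) (hv : Algebra.IsUnramifiedIn (𝓞 L) v.asIdeal) :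
    W.asIdeal.inertiaDeg (𝓞 F) ≠ Module.finrank F L := by
  intro heq
  obtain ⟨g, h, hgh⟩ := hG
  haveI : Module.Finite (𝓞 F) (𝓞 L) := IsIntegralClosure.finite (𝓞 F) F L (𝓞 L)
  haveI : IsGaloisGroup (L ≃ₐ[F] L) (𝓞 F) (𝓞 L) := IsGaloisGroup.of_isFractionRing _ _ _ F L
  haveI := W.isPrime
  haveI := v.isPrime
  haveI := W.isMaximal
  haveI := v.isMaximal
  haveI : W.asIdeal.LiesOver v.asIdeal := ⟨hW.symm⟩
  -- the decomposition group is everything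
  have htop : MulAction.stabilizer (L ≃ₐ[F] L) W.asIdeal = ⊤ := by
    rw [← HeightOneSpectrum.stabilizer_eq_stabilizer_asIdeal]
    refine Subgroup.eq_top_of_card_eq _ ?_
    rw [HeightOneSpectrum.card_stabilizer_eq_inertiaDeg hW hv, heq, IsGalois.card_aut_eq_finrank]
  -- the action on the residue field is faithful (inertia is trivial)
  set φ := Ideal.Quotient.stabilizerHom W.asIdeal v.asIdeal (L ≃ₐ[F] L) with hφ
  have hinj : Function.Injective φ := by
    rw [← MonoidHom.ker_eq_bot_iff]
    refine Subgroup.eq_bot_of_card_eq _ ?_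
    rw [← Subgroup.card_subtype _ φ.ker, hφ, Ideal.Quotient.map_ker_stabilizer_subtype,
      Ideal.card_inertia_eq_ramificationIdxIn (G := L ≃ₐ[F] L) v.asIdeal W.asIdeal,
      Ideal.ramificationIdxIn_eq_ramificationIdx v.asIdeal W.asIdeal (L ≃ₐ[F] L),
      hv.ramificationIdx_eq_one ⟨hW.symm⟩]
  -- and the automorphism group of the residue extension is commutative
  letI := Ideal.Quotient.field W.asIdeal
  letI := Ideal.Quotient.field v.asIdeal
  haveI : Finite (𝓞 L ⧸ W.asIdeal) := Ideal.finiteQuotientOfFreeOfNeBot W.asIdeal W.ne_bot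
  have hcomm : ∀ x y : (𝓞 L ⧸ W.asIdeal) ≃ₐ[𝓞 F ⧸ v.asIdeal] (𝓞 L ⧸ W.asIdeal),
      x * y = y * x := fun x y => by
    obtain ⟨c, hc⟩ :=
      IsCyclic.exists_generator (α := (𝓞 L ⧸ W.asIdeal) ≃ₐ[𝓞 F ⧸ v.asIdeal] (𝓞 L ⧸ W.asIdeal))
    obtain ⟨m, rfl⟩ := hc x
    obtain ⟨n, rfl⟩ := hc y
    exact zpow_mul_comm c m n
  have hg : g ∈ MulAction.stabilizer (L ≃ₐ[F] L) W.asIdeal := htop ▸ Subgroup.mem_top g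
  have hh : h ∈ MulAction.stabilizer (L ≃ₐ[F] L) W.asIdeal := htop ▸ Subgroup.mem_top h
  have key : φ (⟨g, hg⟩ * ⟨h, hh⟩) = φ (⟨h, hh⟩ * ⟨g, hg⟩) := by
    rw [map_mul, map_mul, hcomm]
  exact hgh (congrArg Subtype.val (hinj key))

end GaloisPlaces

/-! ### The sextic diagram: places above a place of `F` split in `K` -/

section Diagram

variable {F K L E : Type} [Field F] [NumberField F] [Field K] [NumberField K]
  [Field L] [NumberField L] [Field E] [NumberField E]
  [Algebra F K] [Algebra K L] [Algebra F L] [IsScalarTower F K L]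
  [Algebra F E] [Algebra E L] [IsScalarTower F E L]

omit [NumberField F] [NumberField K] [NumberField L] [Algebra F E] [IsScalarTower F E L] [NumberField E] in
/-- A `K`-automorphism of `L` and its restriction of scalars to `F` move places alike. [folklore] -/
theorem HeightOneSpectrum.restrictScalars_smul (a : L ≃ₐ[K] L) (W : HeightOneSpectrum (𝓞 L)) :
    a.restrictScalars F • W = a • W :=
  rfl

omit [NumberField F] in
/-- **At a place of `F` split in `K`, the places of `L` above it are unramified of degree `1`
over `E`, with `f(W | W ∩ K) = f(W ∩ E | v)`** (`[L:K] = 3`, `[L:E] = 2`, `L/F` Galois):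
`f(W|v) = f(W|V) ∣ 3` and `f(W|v) = f(w|v) f(W|w)` with `f(W|w) ∣ 2`. [folklore] -/
theorem HeightOneSpectrum.inertiaDeg_of_resolventSplit [IsGalois F L]
    (hKL : Module.finrank K L = 3) (hEL : Module.finrank E L = 2)
    {V : HeightOneSpectrum (𝓞 K)} {W : HeightOneSpectrum (𝓞 L)}
    (hWV : W.asIdeal.under (𝓞 K) = V.asIdeal) (hsplit : V.asIdeal.inertiaDeg (𝓞 F) = 1) :
    W.asIdeal.inertiaDeg (𝓞 E) = 1 ∧
      W.asIdeal.inertiaDeg (𝓞 K) = (W.asIdeal.under (𝓞 E)).inertiaDeg (𝓞 F) ∧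
        W.asIdeal.inertiaDeg (𝓞 F) = W.asIdeal.inertiaDeg (𝓞 K) := by
  haveI : IsGalois K L := IsGalois.tower_top_of_isGalois F K L
  haveI : IsGalois E L := IsGalois.tower_top_of_isGalois F E L
  haveI : W.asIdeal.LiesOver V.asIdeal := ⟨hWV.symm⟩
  haveI : W.asIdeal.LiesOver (W.asIdeal.under (𝓞 E)) := ⟨rfl⟩
  have hK : W.asIdeal.inertiaDeg (𝓞 K) ∣ 3 := hKL ▸ HeightOneSpectrum.inertiaDeg_dvd_finrank hWV
  have hE : W.asIdeal.inertiaDeg (𝓞 E) ∣ 2 := hEL ▸ HeightOneSpectrum.inertiaDeg_dvd_finrank (v := W.under (𝓞 E)) rfl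
  have htK : W.asIdeal.inertiaDeg (𝓞 F) = V.asIdeal.inertiaDeg (𝓞 F) * W.asIdeal.inertiaDeg (𝓞 K) :=
    Ideal.inertiaDeg_tower V.asIdeal W.asIdeal
  have htE : W.asIdeal.inertiaDeg (𝓞 F) =
      (W.asIdeal.under (𝓞 E)).inertiaDeg (𝓞 F) * W.asIdeal.inertiaDeg (𝓞 E) :=
    Ideal.inertiaDeg_tower (W.asIdeal.under (𝓞 E)) W.asIdeal
  rw [hsplit, one_mul] at htK
  have hK' := (Nat.dvd_prime Nat.prime_three).1 hK
  have hE' := (Nat.dvd_prime Nat.prime_two).1 hE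
  rcases hE' with hE1 | hE2
  · refine ⟨hE1, ?_, htK⟩
    rw [← htK, htE, hE1, mul_one]
  · exfalso
    have h2 : 2 ∣ W.asIdeal.inertiaDeg (𝓞 K) := ⟨_, by rw [← htK, htE, hE2, mul_comm]⟩
    rcases hK' with h1 | h3
    · rw [h1] at h2; exact absurd h2 (by norm_num)
    · rw [h3] at h2; exact absurd h2 (by norm_num)

/-- **At a place of `F` inert in `K`, in the `S₃` case** (`Gal(L/F)` non-abelian; `[L:K] = 3`,
`[L:E] = 2`, `[L:F] = 6`, `v` unramified in `L`): every place `W` of `L` above the place `V` of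
`K` over `v` has `f(W|V) = 1` and `f(W|v) = 2` (as `f(W|v) = 2 f(W|V) ≠ 6`,
`inertiaDeg_ne_finrank_of_mul_ne`), and `W ∩ E` is either a degree-`2` place of `E` over `v`
split in `L` or a degree-`1` place inert in `L`: the splitting type `(1, 2)` of `v` in `E`
(Frobenius a transposition).  Hence the factor of `exists_cuspidal_cubic_resolvent` at an inert
`v` is `(X - θ(ϖ_{w₁})²)(X - θ(ϖ_{w₂}))²`. [folklore] -/
theorem HeightOneSpectrum.inertiaDeg_of_resolventInert [IsGalois F L]
    (hG : ∃ g h : L ≃ₐ[F] L, g * h ≠ h * g) (hFL : Module.finrank F L = 6)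
    (hKL : Module.finrank K L = 3) (hEL : Module.finrank E L = 2)
    {v : HeightOneSpectrum (𝓞 F)} {V : HeightOneSpectrum (𝓞 K)} {W : HeightOneSpectrum (𝓞 L)}
    (hV : V.asIdeal.under (𝓞 F) = v.asIdeal) (hWV : W.asIdeal.under (𝓞 K) = V.asIdeal)
    (hinert : V.asIdeal.inertiaDeg (𝓞 F) = 2) (hv : Algebra.IsUnramifiedIn (𝓞 L) v.asIdeal) :
    W.asIdeal.inertiaDeg (𝓞 K) = 1 ∧ W.asIdeal.inertiaDeg (𝓞 F) = 2 ∧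
      (W.asIdeal.inertiaDeg (𝓞 E) = 1 ∧ (W.asIdeal.under (𝓞 E)).inertiaDeg (𝓞 F) = 2 ∨
        W.asIdeal.inertiaDeg (𝓞 E) = 2 ∧ (W.asIdeal.under (𝓞 E)).inertiaDeg (𝓞 F) = 1) := by
  haveI : IsGalois K L := IsGalois.tower_top_of_isGalois F K L
  haveI : IsGalois E L := IsGalois.tower_top_of_isGalois F E L
  haveI : W.asIdeal.LiesOver V.asIdeal := ⟨hWV.symm⟩
  haveI : W.asIdeal.LiesOver (W.asIdeal.under (𝓞 E)) := ⟨rfl⟩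
  have hWv : W.asIdeal.under (𝓞 F) = v.asIdeal := by
    rw [← Ideal.under_under (B := 𝓞 K) W.asIdeal, hWV, hV]
  have hK : W.asIdeal.inertiaDeg (𝓞 K) ∣ 3 := hKL ▸ HeightOneSpectrum.inertiaDeg_dvd_finrank hWV
  have hE : W.asIdeal.inertiaDeg (𝓞 E) ∣ 2 :=
    hEL ▸ HeightOneSpectrum.inertiaDeg_dvd_finrank (v := W.under (𝓞 E)) rfl
  have htK : W.asIdeal.inertiaDeg (𝓞 F) = V.asIdeal.inertiaDeg (𝓞 F) * W.asIdeal.inertiaDeg (𝓞 K) :=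
    Ideal.inertiaDeg_tower V.asIdeal W.asIdeal
  have htE : W.asIdeal.inertiaDeg (𝓞 F) =
      (W.asIdeal.under (𝓞 E)).inertiaDeg (𝓞 F) * W.asIdeal.inertiaDeg (𝓞 E) :=
    Ideal.inertiaDeg_tower (W.asIdeal.under (𝓞 E)) W.asIdeal
  have h6 : W.asIdeal.inertiaDeg (𝓞 F) ≠ 6 :=
    hFL ▸ HeightOneSpectrum.inertiaDeg_ne_finrank_of_mul_ne hG hWv hv
  rw [hinert] at htK
  have hK1 : W.asIdeal.inertiaDeg (𝓞 K) = 1 := by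
    rcases (Nat.dvd_prime Nat.prime_three).1 hK with h1 | h3
    · exact h1
    · exfalso; exact h6 (by rw [htK, h3])
  have hF2 : W.asIdeal.inertiaDeg (𝓞 F) = 2 := by rw [htK, hK1]
  refine ⟨hK1, hF2, ?_⟩
  rw [hF2] at htE
  rcases (Nat.dvd_prime Nat.prime_two).1 hE with h1 | h2
  · left
    exact ⟨h1, by rw [h1, mul_one] at htE; exact htE.symm⟩
  · right
    refine ⟨h2, ?_⟩
    rw [h2] at htE
    omega

/-- **At a place of `F` split in `K`, `W ↦ W ∩ E` is a bijection from the places of `L` above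
a place `V ∣ v` of `K` onto the places of `E` above `v`** (`L/F` Galois of degree `6`,
`[L:K] = 3`, `[L:E] = 2`, `v` unramified in `L`).  Injectivity: two places of `L` over the same
`V` and the same `w` differ by some `a ∈ Gal(L/K)` and by some `s ∈ Gal(L/E)`, so `s⁻¹ a` lies
in the decomposition group `D_W`, of order `f(W|v) = f(W|V) ∈ {1, 3}`; if `1`, `a = s` forces
`s = 1`; if `3`, `W` is the only place above `V`.  Surjectivity: a place `W₀` of `L` above
`w' ∣ v` is `g W` with `g = s a` (`exists_eq_restrictScalars_mul_restrictScalars`), and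
`a W = s⁻¹ W₀` lies over `V` and over `w'`. [folklore] -/
theorem HeightOneSpectrum.placesOver_resolventSplit [IsGalois F L]
    (hFL : Module.finrank F L = 6) (hKL : Module.finrank K L = 3) (hEL : Module.finrank E L = 2)
    {v : HeightOneSpectrum (𝓞 F)} {V : HeightOneSpectrum (𝓞 K)} {W : HeightOneSpectrum (𝓞 L)}
    (hV : V.asIdeal.under (𝓞 F) = v.asIdeal) (hWV : W.asIdeal.under (𝓞 K) = V.asIdeal)
    (hsplit : V.asIdeal.inertiaDeg (𝓞 F) = 1) (hv : Algebra.IsUnramifiedIn (𝓞 L) v.asIdeal)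
    (hVu : Algebra.IsUnramifiedIn (𝓞 L) V.asIdeal) :
    (∀ W' : HeightOneSpectrum (𝓞 L), W'.asIdeal.under (𝓞 K) = V.asIdeal →
        W'.asIdeal.under (𝓞 E) = W.asIdeal.under (𝓞 E) → W' = W) ∧
      (∀ w' : HeightOneSpectrum (𝓞 E), w'.asIdeal.under (𝓞 F) = v.asIdeal →
        ∃ W' : HeightOneSpectrum (𝓞 L), W'.asIdeal.under (𝓞 K) = V.asIdeal ∧
          W'.asIdeal.under (𝓞 E) = w'.asIdeal) := by
  haveI : IsGalois K L := IsGalois.tower_top_of_isGalois F K L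
  haveI : IsGalois E L := IsGalois.tower_top_of_isGalois F E L
  haveI : FiniteDimensional F L := Module.Finite.of_restrictScalars_finite ℚ F L
  haveI : FiniteDimensional K L := Module.Finite.of_restrictScalars_finite ℚ K L
  haveI : FiniteDimensional E L := Module.Finite.of_restrictScalars_finite ℚ E L
  have hWv : W.asIdeal.under (𝓞 F) = v.asIdeal := by
    rw [← Ideal.under_under (B := 𝓞 K) W.asIdeal, hWV, hV]
  obtain ⟨-, -, hfF⟩ := HeightOneSpectrum.inertiaDeg_of_resolventSplit hKL hEL hWV hsplit
  constructor
  · intro W' hW'V hW'E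
    obtain ⟨a, ha⟩ := HeightOneSpectrum.exists_algEquiv_smul_eq (F := K) (w := W) (w' := W')
      (HeightOneSpectrum.ext (hWV.trans hW'V.symm))
    obtain ⟨s, hs⟩ := HeightOneSpectrum.exists_algEquiv_smul_eq (F := E) (w := W) (w' := W')
      (HeightOneSpectrum.ext hW'E.symm)
    have hg : ((s.restrictScalars F)⁻¹ * a.restrictScalars F) • W = W := by
      rw [mul_smul, HeightOneSpectrum.restrictScalars_smul, ha, ← hs,
        ← HeightOneSpectrum.restrictScalars_smul (F := F) s, inv_smul_smul]
    rcases (Nat.dvd_prime Nat.prime_three).1 (hKL ▸ HeightOneSpectrum.inertiaDeg_dvd_finrank hWV) with h1 | h3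
    · have hcard : Nat.card (MulAction.stabilizer (L ≃ₐ[F] L) W) = 1 := by
        rw [HeightOneSpectrum.card_stabilizer_eq_inertiaDeg hWv hv, hfF, h1]
      have hmem : (s.restrictScalars F)⁻¹ * a.restrictScalars F ∈
          MulAction.stabilizer (L ≃ₐ[F] L) W := hg
      rw [Subgroup.eq_bot_of_card_eq _ hcard, Subgroup.mem_bot, inv_mul_eq_one] at hmem
      obtain ⟨hs1, -⟩ := algEquiv_eq_one_of_restrictScalars_eq (F := F) hKL hEL hmem.symm
      rw [← hs, hs1, one_smul]
    · have hcard : Nat.card (MulAction.stabilizer (L ≃ₐ[K] L) W) = Module.finrank K L := by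
        rw [HeightOneSpectrum.card_stabilizer_eq_inertiaDeg hWV hVu, h3, hKL]
      rw [← ha, HeightOneSpectrum.smul_eq_self_of_card_stabilizer_eq hcard a]
  · intro w' hw'
    obtain ⟨W₀, hW₀⟩ := exists_above (E := L) w'
    have hW₀v : W₀.asIdeal.under (𝓞 F) = v.asIdeal := by
      rw [← Ideal.under_under (B := 𝓞 E) W₀.asIdeal, hW₀, hw']
    obtain ⟨g, hg⟩ := HeightOneSpectrum.exists_algEquiv_smul_eq (F := F) (w := W) (w' := W₀)
      (HeightOneSpectrum.ext (hWv.trans hW₀v.symm))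
    obtain ⟨s, a, rfl⟩ := exists_eq_restrictScalars_mul_restrictScalars hFL hKL hEL g
    have e1 : a • W = s⁻¹ • W₀ := by
      rw [← hg, mul_smul, HeightOneSpectrum.restrictScalars_smul,
        HeightOneSpectrum.restrictScalars_smul (F := F) a, inv_smul_smul]
    refine ⟨a • W, ?_, ?_⟩
    · rw [← hWV]
      exact congrArg HeightOneSpectrum.asIdeal (HeightOneSpectrum.under_algEquiv_smul K L a W)
    · rw [e1, ← hW₀]
      exact congrArg HeightOneSpectrum.asIdeal (HeightOneSpectrum.under_algEquiv_smul E L s⁻¹ W₀)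

/-- **Reindexing the induced local factor along `W ↦ W ∩ E` at a place split in `K`.**  In the
setting of `placesOver_resolventSplit`, for a family `b` on the places of `L` with
`b(W') = θ(ϖ_{W' ∩ E})^{f(W' | W' ∩ E)}` above `V` (the values of `θ ∘ N_{L/E}` at unramified
uniformisers), `∏_{W' ∣ V} (X^{f(W'|V)} - b(W')) = ∏_{w ∣ v} (X^{f(w|v)} - θ(ϖ_w))`: the induced
Satake polynomial at `V` of `θ_L = θ ∘ N_{L/E}` along `L/K` is the induced Satake polynomial at `v`
of `θ` along `E/F`. [folklore] -/
theorem finprod_resolventSplit_eq [IsGalois F L]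
    (hFL : Module.finrank F L = 6) (hKL : Module.finrank K L = 3) (hEL : Module.finrank E L = 2)
    {v : HeightOneSpectrum (𝓞 F)} {V : HeightOneSpectrum (𝓞 K)} {W : HeightOneSpectrum (𝓞 L)}
    (hV : V.asIdeal.under (𝓞 F) = v.asIdeal) (hWV : W.asIdeal.under (𝓞 K) = V.asIdeal)
    (hsplit : V.asIdeal.inertiaDeg (𝓞 F) = 1) (hv : Algebra.IsUnramifiedIn (𝓞 L) v.asIdeal)
    (hVu : Algebra.IsUnramifiedIn (𝓞 L) V.asIdeal)
    (θ : GaloisRepresentations.HeckeCharacter E) {b : HeightOneSpectrum (𝓞 L) → ℂ}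
    (hb : ∀ W' : HeightOneSpectrum (𝓞 L), W'.asIdeal.under (𝓞 K) = V.asIdeal →
      b W' = θ.valueAtUniformizer (W'.under (𝓞 E)) ^ W'.asIdeal.inertiaDeg (𝓞 E)) :
    ∏ᶠ W' ∈ {W' : HeightOneSpectrum (𝓞 L) | W'.under (𝓞 K) = V},
        (X ^ W'.asIdeal.inertiaDeg (𝓞 K) - C (b W')) =
      ∏ᶠ w ∈ {w : HeightOneSpectrum (𝓞 E) | w.under (𝓞 F) = v},
        (X ^ w.asIdeal.inertiaDeg (𝓞 F) - C (θ.valueAtUniformizer w)) := by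
  obtain ⟨-, hsurj⟩ :=
    HeightOneSpectrum.placesOver_resolventSplit hFL hKL hEL hV hWV hsplit hv hVu
  refine finprod_mem_eq_of_bijOn (fun W' => W'.under (𝓞 E)) ⟨?_, ?_, ?_⟩ ?_
  · intro W' hW'
    have hW'V : W'.asIdeal.under (𝓞 K) = V.asIdeal :=
      congrArg HeightOneSpectrum.asIdeal (show W'.under (𝓞 K) = V from hW')
    apply HeightOneSpectrum.ext
    show (W'.asIdeal.under (𝓞 E)).under (𝓞 F) = v.asIdeal
    rw [Ideal.under_under, ← Ideal.under_under (B := 𝓞 K) W'.asIdeal, hW'V, hV]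
  · intro W₁ h₁ W₂ h₂ h12
    have h₁' : W₁.asIdeal.under (𝓞 K) = V.asIdeal :=
      congrArg HeightOneSpectrum.asIdeal (show W₁.under (𝓞 K) = V from h₁)
    have h₂' : W₂.asIdeal.under (𝓞 K) = V.asIdeal :=
      congrArg HeightOneSpectrum.asIdeal (show W₂.under (𝓞 K) = V from h₂)
    obtain ⟨hinj, -⟩ :=
      HeightOneSpectrum.placesOver_resolventSplit hFL hKL hEL hV h₂' hsplit hv hVu
    exact hinj W₁ h₁' (congrArg HeightOneSpectrum.asIdeal h12)
  · intro w' hw'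
    obtain ⟨W', h1, h2⟩ := hsurj w'
      (congrArg HeightOneSpectrum.asIdeal (show w'.under (𝓞 F) = v from hw'))
    exact ⟨W', HeightOneSpectrum.ext h1, HeightOneSpectrum.ext h2⟩
  · intro W' hW'
    have hW'V : W'.asIdeal.under (𝓞 K) = V.asIdeal :=
      congrArg HeightOneSpectrum.asIdeal (show W'.under (𝓞 K) = V from hW')
    obtain ⟨hfE, hfK, -⟩ := HeightOneSpectrum.inertiaDeg_of_resolventSplit hKL hEL hW'V hsplit
    rw [hb W' hW'V, hfE, pow_one, hfK]
    rfl

/-- **The induced local factor is the same at the two places of `K` above a split place, and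
there is only one place above an inert one.**  In the sextic diagram (`L/F` Galois of degree
`6`, `K/F` Galois quadratic, `[L:K] = 3`, `[L:E] = 2`), at a place `v` of `F` unramified in `L`
and in `K`, for a family `b` as in `finprod_resolventSplit_eq` above every place of `K` over `v`,
the polynomials `∏_{W ∣ V} (X^{f(W|V)} - b(W))` agree for all places `V, V'` of `K` above `v`:
at a split `v` both are `∏_{w ∣ v} (X^{f(w|v)} - θ(ϖ_w))`, at an inert `v` (`f(V|v) = 2 = #D_V`)
`V' = V`.  This is the `Gal(K/F)`-stability of the Satake data of `AI_{L/K}(θ ∘ N_{L/E})`.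
[folklore] -/
theorem finprod_eq_finprod_of_under_eq [IsGalois F L] [IsGalois F K]
    (hFL : Module.finrank F L = 6) (hFK : Module.finrank F K = 2)
    (hKL : Module.finrank K L = 3) (hEL : Module.finrank E L = 2)
    {v : HeightOneSpectrum (𝓞 F)} (hvL : Algebra.IsUnramifiedIn (𝓞 L) v.asIdeal)
    (hvK : Algebra.IsUnramifiedIn (𝓞 K) v.asIdeal)
    (hVu : ∀ V : HeightOneSpectrum (𝓞 K), V.asIdeal.under (𝓞 F) = v.asIdeal →
      Algebra.IsUnramifiedIn (𝓞 L) V.asIdeal)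
    (θ : GaloisRepresentations.HeckeCharacter E) {b : HeightOneSpectrum (𝓞 L) → ℂ}
    (hb : ∀ V : HeightOneSpectrum (𝓞 K), V.asIdeal.under (𝓞 F) = v.asIdeal →
      ∀ W' : HeightOneSpectrum (𝓞 L), W'.asIdeal.under (𝓞 K) = V.asIdeal →
        b W' = θ.valueAtUniformizer (W'.under (𝓞 E)) ^ W'.asIdeal.inertiaDeg (𝓞 E))
    {V V' : HeightOneSpectrum (𝓞 K)} (hV : V.asIdeal.under (𝓞 F) = v.asIdeal)
    (hV' : V'.asIdeal.under (𝓞 F) = v.asIdeal) :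
    ∏ᶠ W ∈ {W : HeightOneSpectrum (𝓞 L) | W.under (𝓞 K) = V},
        (X ^ W.asIdeal.inertiaDeg (𝓞 K) - C (b W)) =
      ∏ᶠ W ∈ {W : HeightOneSpectrum (𝓞 L) | W.under (𝓞 K) = V'},
        (X ^ W.asIdeal.inertiaDeg (𝓞 K) - C (b W)) := by
  haveI : FiniteDimensional F K := Module.Finite.of_restrictScalars_finite ℚ F K
  by_cases hsplit : V.asIdeal.inertiaDeg (𝓞 F) = 1
  · -- split: both sides are the induced factor of `θ` along `E/F`
    have hsplit' : V'.asIdeal.inertiaDeg (𝓞 F) = 1 := by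
      rw [inertiaDeg_eq_inertiaDegIn_of_under_eq v hV', ← inertiaDeg_eq_inertiaDegIn_of_under_eq v hV,
        hsplit]
    obtain ⟨W, hW⟩ := exists_above (E := L) V
    obtain ⟨W', hW'⟩ := exists_above (E := L) V'
    rw [finprod_resolventSplit_eq hFL hKL hEL hV hW hsplit hvL (hVu V hV) θ (hb V hV),
      finprod_resolventSplit_eq hFL hKL hEL hV' hW' hsplit' hvL (hVu V' hV') θ (hb V' hV')]
  · -- inert: `V' = V`
    obtain ⟨σ, rfl⟩ := HeightOneSpectrum.exists_algEquiv_smul_eq (F := F) (w := V) (w' := V')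
      (HeightOneSpectrum.ext (hV.trans hV'.symm))
    have h2 : V.asIdeal.inertiaDeg (𝓞 F) = 2 :=
      (inertiaDeg_eq_one_or_two_of_finrank_eq_two hFK v V hV).resolve_left hsplit
    have hcard : Nat.card (MulAction.stabilizer (K ≃ₐ[F] K) V) = Module.finrank F K := by
      rw [HeightOneSpectrum.card_stabilizer_eq_inertiaDeg hV hvK, h2, hFK]
    rw [HeightOneSpectrum.smul_eq_self_of_card_stabilizer_eq hcard σ]

end Diagram

/-! ### The sign-blind descent: `AI_{L/K}(θ ∘ N_{L/E})` descends to `GL₃(𝔸_F)` -/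

section Descent

variable {F K L E : Type} [Field F] [NumberField F] [Field K] [NumberField K]
  [Field L] [NumberField L] [Field E] [NumberField E]
  [Algebra F K] [Algebra K L] [Algebra F L] [IsScalarTower F K L]
  [Algebra F E] [Algebra E L] [IsScalarTower F E L]

/-- **The resolvent descent (sign-blind half of non-normal cubic automorphic induction).**  Let
`L/F` be Galois with a quadratic Galois subextension `K/F` and subextensions `E/F` with
`[L:K] = 3`, `[L:E] = 2` (for a NON-normal cubic `E/F`: `L` its Galois closure, `K` its quadratic
resolvent, `Gal(L/F) ≅ S₃`; for a cyclic cubic `E/F` any quadratic `K` and `L = EK`).  Let `θ`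
be a Hecke character of `E` whose base change `θ_L = θ ∘ N_{L/E}` is not `Gal(L/K)`-stable at
infinitely many places.  Granting Arthur–Clozel's cyclic automorphic induction of prime degree
(`automorphicInduction_cyclic_cuspidal`, along the cyclic cubic `L/K`) and cyclic descent of prime
degree (`cuspidal_descent_cyclic`, along the quadratic `K/F`), there are CUSPIDAL automorphic
representations `P` of `GL₃(𝔸_K)` and `π` of `GL₃(𝔸_F)` with
`det(X - t_{P,V}) = ∏_{W ∣ V} (X^{f(W|V)} - θ_L(ϖ_W))` for almost all `V` (`P = AI_{L/K}(θ_L)`)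
and `t_{P,V} = t_{π,v}^{f(V|v)}` for almost all `V ∣ v` (`P = BC_{K/F}(π)`,
`IsWeakBaseChangeLiftAE`).  The `Gal(K/F)`-stability of `P` needed for the descent is
`finprod_eq_finprod_of_under_eq`: above a place of `F` split in `K` the induced factor of `θ_L` is
the induced factor of `θ` along `E/F` at BOTH places of `K` (`finprod_resolventSplit_eq`), and
above an inert place there is a single place of `K`.  This is everything the cyclic theory gives
towards `automorphicInduction_unitaryCharacter_cubic` for non-normal `E/F`: at the places of `F`
inert in `K` only `t_{π,v}^2` is determined (the sign ambiguity; see the module docstring).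
[cite: ArthurClozelAMS120, Ch. 3 Thm. 6.2, Lemma 6.4 and Thm. 4.2 (d)]
[cite: Gelbart1997, Thm. 5.3.1 and Remark 5.3.1 (e)] -/
theorem exists_cuspidal_resolventDescent
    (hAIc : automorphicInduction_cyclic_cuspidal) (hD : cuspidal_descent_cyclic)
    [IsGalois F L] [IsGalois F K] [IsGalois E L]
    (hFK : Module.finrank F K = 2) (hKL : Module.finrank K L = 3) (hEL : Module.finrank E L = 2)
    (θ : GaloisRepresentations.HeckeCharacter E)
    (hθL : ∃ᶠ W : HeightOneSpectrum (𝓞 L) in cofinite, ∃ W' : HeightOneSpectrum (𝓞 L),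
      W'.asIdeal.under (𝓞 K) = W.asIdeal.under (𝓞 K) ∧
        (θ.baseChange L).valueAtUniformizer W' ≠ (θ.baseChange L).valueAtUniformizer W)
    (hF : isCompact_glFiniteIntegralLevel 3 F) (hK : isCompact_glFiniteIntegralLevel 3 K) :
    ∃ (π : CuspidalAutomorphicRepData 3 F hF) (P : CuspidalAutomorphicRepData 3 K hK),
      IsWeakBaseChangeLiftAE π.1 P.1 ∧
        ∀ᶠ V : HeightOneSpectrum (𝓞 K) in cofinite, ∃ α : Multiset ℂ,
          P.1.HasSatakeParamAt V α ∧
            satakePolynomial α =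
              ∏ᶠ W ∈ {W : HeightOneSpectrum (𝓞 L) | W.under (𝓞 K) = V},
                (X ^ W.asIdeal.inertiaDeg (𝓞 K) - C ((θ.baseChange L).valueAtUniformizer W)) := by
  haveI : IsGalois K L := IsGalois.tower_top_of_isGalois F K L
  haveI : FiniteDimensional F L := Module.Finite.of_restrictScalars_finite ℚ F L
  haveI : FiniteDimensional F K := Module.Finite.of_restrictScalars_finite ℚ F K
  haveI : FiniteDimensional K L := Module.Finite.of_restrictScalars_finite ℚ K L
  have hFL : Module.finrank F L = 6 := by rw [← Module.finrank_mul_finrank F K L, hFK, hKL]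
  have hp3 : (Module.finrank K L).Prime := hKL ▸ Nat.prime_three
  have hp2 : (Module.finrank F K).Prime := hFK ▸ Nat.prime_two
  have hcycL : IsCyclic (L ≃ₐ[K] L) := isCyclic_algEquiv_of_finrank_prime hp3
  have hcycK : IsCyclic (K ≃ₐ[F] K) := isCyclic_algEquiv_of_finrank_prime hp2
  set θL := θ.baseChange L with hθLdef
  -- `θ_L` as a cuspidal datum on `GL₁(𝔸_L)`, induced along the cyclic cubic `L/K`
  set hL1 := isCompact_glFiniteIntegralLevel_holds 1 L
  obtain ⟨τ, hτ⟩ := exists_automorphicRepData_hasSatakeParamAt_valueAtUniformizer hL1 θL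
  set hK' := isCompact_glFiniteIntegralLevel_holds (1 * Module.finrank K L) K
  obtain ⟨P, hP⟩ := hAIc 1 K L hcycL hp3 one_pos hL1 hK' ⟨τ, τ.W_le_cuspFormsGL_one⟩
    (not_isGaloisStableSatakeAE_of_frequently_ne θL hτ hθL)
  have hP' := (isAutomorphicInductionAlong_iff_of_hasSatakeParamAt_singleton θL hτ P.1).1 hP
  obtain ⟨P3, hP3⟩ := CuspidalAutomorphicRepData.exists_hasSatakeParamAt_iff_of_eq
    (show 1 * Module.finrank K L = 3 by rw [hKL]) hK' hK P
  -- the Satake data of `P3`, as an iff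
  have hQ : ∀ᶠ V : HeightOneSpectrum (𝓞 K) in cofinite, ∀ α : Multiset ℂ,
      P3.1.HasSatakeParamAt V α ↔ satakePolynomial α =
        ∏ᶠ W ∈ {W : HeightOneSpectrum (𝓞 L) | W.under (𝓞 K) = V},
          (X ^ W.asIdeal.inertiaDeg (𝓞 K) - C (θL.valueAtUniformizer W)) := by
    filter_upwards [hP'] with V hV α
    obtain ⟨α₀, hα₀, hα₀θ⟩ := hV
    constructor
    · intro hα
      rw [← hα₀θ, P.1.hasSatakeParamAt_unique_holds ((hP3 V α).1 hα) hα₀]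
    · intro hα
      have e : α = α₀ := by
        rw [← roots_satakePolynomial α, ← roots_satakePolynomial α₀, hα, hα₀θ]
      rw [e]
      exact (hP3 V α₀).2 hα₀
  -- `θ_L` at uniformisers, unramifiedness, collected above each place of `F`
  have hθLW : ∀ᶠ W : HeightOneSpectrum (𝓞 L) in cofinite, θL.valueAtUniformizer W =
      θ.valueAtUniformizer (W.under (𝓞 E)) ^ W.asIdeal.inertiaDeg (𝓞 E) :=
    θ.eventually_valueAtUniformizer_baseChange (E := L)
  have hurK : ∀ᶠ V : HeightOneSpectrum (𝓞 K) in cofinite,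
      Algebra.IsUnramifiedIn (𝓞 L) V.asIdeal :=
    Filter.eventually_cofinite.2 (GaloisRepresentations.finite_setOf_not_isUnramifiedIn K L)
  have hurF : ∀ᶠ v : HeightOneSpectrum (𝓞 F) in cofinite,
      Algebra.IsUnramifiedIn (𝓞 L) v.asIdeal ∧ Algebra.IsUnramifiedIn (𝓞 K) v.asIdeal :=
    (Filter.eventually_cofinite.2 (GaloisRepresentations.finite_setOf_not_isUnramifiedIn F L)).and
      (Filter.eventually_cofinite.2 (GaloisRepresentations.finite_setOf_not_isUnramifiedIn F K))
  have hgood := hurF.and (eventually_forall_under_eq (F := F)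
    (hQ.and ((eventually_forall_under_eq (F := K) hθLW).and hurK)))
  -- `Gal(K/F)`-stability of the Satake data of `P3`
  have hst : IsGaloisStableSatakeAE F P3.1 := by
    filter_upwards [eventually_under (E := K) hgood] with V hV V' hV'V α hα
    obtain ⟨⟨hvL, hvK⟩, hgv⟩ := hV (V.under (𝓞 F)) rfl
    obtain ⟨hQV, -, -⟩ := hgv V rfl
    obtain ⟨hQV', -, -⟩ := hgv V' hV'V
    rw [hQV'] 
    rw [hQV] at hα
    rw [hα]
    exact finprod_eq_finprod_of_under_eq hFL hFK hKL hEL hvL hvK (fun V₁ hV₁ => (hgv V₁ hV₁).2.2)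
      θ (fun V₁ hV₁ => (hgv V₁ hV₁).2.1) rfl hV'V
  -- descent along `K/F`
  obtain ⟨π, hπ⟩ := hD 3 F K hF hK hcycK hp2 P3 hst
  refine ⟨π, P3, hπ, ?_⟩
  filter_upwards [hQ, P3.1.hasSatakeParamAt_cofinite_holds] with V hQV hunr
  obtain ⟨α, hα⟩ := hunr
  exact ⟨α, hα, (hQV α).1 hα⟩

/-- **Non-normal cubic automorphic induction at the places split in the quadratic resolvent**
(the half of `automorphicInduction_unitaryCharacter_cubic` reachable from the cyclic theory).
In the setting of `exists_cuspidal_resolventDescent` (e.g. `E/F` a non-normal cubic extension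
with Galois closure `L` and quadratic resolvent `K`, and `θ` a Hecke character of `E` with
`θ ∘ N_{L/E}` not `Gal(L/K)`-stable at infinitely many places), granting
`automorphicInduction_cyclic_cuspidal` and `cuspidal_descent_cyclic` there is a CUSPIDAL
automorphic representation `π` of `GL₃(𝔸_F)` such that, for almost every finite place `v` of `F`
that SPLITS in `K`, `det(X - t_{π,v}) = ∏_{w ∣ v} (X^{f(w|v)} - θ(ϖ_w))` — the local identity of
the fact.  (At a split `v` the base-change relation `t_{P,V} = t_{π,v}` and
`finprod_resolventSplit_eq` conclude.)  At the places inert in `K` the relation only gives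
`t_{P,V} = t_{π,v}²`; fixing the remaining signs is exactly the non-normal cubic lifting of
Jacquet–Piatetski-Shapiro–Shalika (converse theorem for `GL(3)`), which the tree does not have.
[cite: ArthurClozelAMS120, Ch. 3 Thm. 6.2, Lemma 6.4 and Thm. 4.2 (d)]
[cite: Gelbart1997, Thm. 5.3.1 and Remark 5.3.1 (e)]
[cite: JacquetPiatetskishapiroShalika1979II, §§13–14] -/
theorem exists_cuspidal_cubic_resolventSplit
    (hAIc : automorphicInduction_cyclic_cuspidal) (hD : cuspidal_descent_cyclic)
    [IsGalois F L] [IsGalois F K] [IsGalois E L]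
    (hFK : Module.finrank F K = 2) (hKL : Module.finrank K L = 3) (hEL : Module.finrank E L = 2)
    (θ : GaloisRepresentations.HeckeCharacter E)
    (hθL : ∃ᶠ W : HeightOneSpectrum (𝓞 L) in cofinite, ∃ W' : HeightOneSpectrum (𝓞 L),
      W'.asIdeal.under (𝓞 K) = W.asIdeal.under (𝓞 K) ∧
        (θ.baseChange L).valueAtUniformizer W' ≠ (θ.baseChange L).valueAtUniformizer W)
    (hF : isCompact_glFiniteIntegralLevel 3 F) :
    ∃ π : CuspidalAutomorphicRepData 3 F hF,
      ∀ᶠ v : HeightOneSpectrum (𝓞 F) in cofinite,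
        (∃ V : HeightOneSpectrum (𝓞 K), V.asIdeal.under (𝓞 F) = v.asIdeal ∧
            V.asIdeal.inertiaDeg (𝓞 F) = 1) →
          ∃ α : Multiset ℂ, π.1.HasSatakeParamAt v α ∧
            satakePolynomial α =
              ∏ᶠ w ∈ {w : HeightOneSpectrum (𝓞 E) | w.under (𝓞 F) = v},
                (X ^ w.asIdeal.inertiaDeg (𝓞 F) - C (θ.valueAtUniformizer w)) := by
  haveI : FiniteDimensional F L := Module.Finite.of_restrictScalars_finite ℚ F L
  haveI : FiniteDimensional F K := Module.Finite.of_restrictScalars_finite ℚ F K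
  haveI : FiniteDimensional K L := Module.Finite.of_restrictScalars_finite ℚ K L
  have hFL : Module.finrank F L = 6 := by rw [← Module.finrank_mul_finrank F K L, hFK, hKL]
  set hK := isCompact_glFiniteIntegralLevel_holds 3 K
  obtain ⟨π, P, hBC, hPQ⟩ := exists_cuspidal_resolventDescent hAIc hD hFK hKL hEL θ hθL hF hK
  have hθLW : ∀ᶠ W : HeightOneSpectrum (𝓞 L) in cofinite, (θ.baseChange L).valueAtUniformizer W =
      θ.valueAtUniformizer (W.under (𝓞 E)) ^ W.asIdeal.inertiaDeg (𝓞 E) :=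
    θ.eventually_valueAtUniformizer_baseChange (E := L)
  have hurK : ∀ᶠ V : HeightOneSpectrum (𝓞 K) in cofinite,
      Algebra.IsUnramifiedIn (𝓞 L) V.asIdeal :=
    Filter.eventually_cofinite.2 (GaloisRepresentations.finite_setOf_not_isUnramifiedIn K L)
  have hurF : ∀ᶠ v : HeightOneSpectrum (𝓞 F) in cofinite,
      Algebra.IsUnramifiedIn (𝓞 L) v.asIdeal :=
    Filter.eventually_cofinite.2 (GaloisRepresentations.finite_setOf_not_isUnramifiedIn F L)
  have hall := π.1.hasSatakeParamAt_cofinite_holds.and (hurF.and (eventually_forall_under_eq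
    (F := F) (hBC.and (hPQ.and ((eventually_forall_under_eq (F := K) hθLW).and hurK)))))
  refine ⟨π, ?_⟩
  filter_upwards [hall] with v hv hsplit
  obtain ⟨⟨α, hα⟩, hvL, hV⟩ := hv
  obtain ⟨V, hVv, hsplit⟩ := hsplit
  obtain ⟨hBCV, ⟨β, hβ, hβQ⟩, hθV, hVu⟩ := hV V hVv
  refine ⟨α, hα, ?_⟩
  have hPα : P.1.HasSatakeParamAt V α := by
    have h := hBCV v α hVv hα
    rw [hsplit] at h
    simpa only [pow_one, Multiset.map_id'] using h
  rw [P.1.hasSatakeParamAt_unique_holds hPα hβ, hβQ]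
  obtain ⟨W, hW⟩ := exists_above (E := L) V
  exact finprod_resolventSplit_eq hFL hKL hEL hVv hW hsplit hvL hVu θ hθV

/-- **What the cyclic theory determines at every unramified place of `F`, split or inert in the
resolvent.**  In the setting of `exists_cuspidal_resolventDescent` there is a cuspidal `π` on
`GL₃(𝔸_F)` such that for almost every finite place `v` of `F`:
* if `v` splits in `K` (`f(V|v) = 1` for a place `V ∣ v` of `K`), then
  `det(X - t_{π,v}) = ∏_{w ∣ v} (X^{f(w|v)} - θ(ϖ_w))` (the local identity of the fact);
* if `v` is inert in `K` (`f(V|v) = 2`), then the SQUARES of the Satake parameters are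
  determined: `det(X - t_{π,v}²) = ∏_{W ∣ V} (X^{f(W|V)} - θ(ϖ_{W ∩ E})^{f(W | W ∩ E)})`, the
  induced factor of `θ ∘ N_{L/E}` at the unique place `V` of `K` above `v`.  For `E/F` non-normal
  (`Gal(L/F) ≅ S₃`, Frobenius at `v` a transposition, `v = w₁ w₂` in `E` with `f = 1, 2`, `w₁`
  inert and `w₂` split in `L`) the right-hand side is `(X - θ(ϖ_{w₁})²)(X - θ(ϖ_{w₂}))²`, which
  leaves `t_{π,v} ∈ {{a, √c, -√c}, {-a, √c, √c}, {-a, -√c, -√c}}` (`a = θ(ϖ_{w₁})`,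
  `c = θ(ϖ_{w₂})`, determinant `-ac` in all three cases) undecided — the sign that only the
  non-normal cubic lifting of Jacquet–Piatetski-Shapiro–Shalika fixes.
[cite: ArthurClozelAMS120, Ch. 3 Thm. 6.2, Lemma 6.4 and Thm. 4.2 (d)]
[cite: Gelbart1997, Thm. 5.3.1 and Remark 5.3.1 (a), (e)] -/
theorem exists_cuspidal_cubic_resolvent
    (hAIc : automorphicInduction_cyclic_cuspidal) (hD : cuspidal_descent_cyclic)
    [IsGalois F L] [IsGalois F K] [IsGalois E L]
    (hFK : Module.finrank F K = 2) (hKL : Module.finrank K L = 3) (hEL : Module.finrank E L = 2)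
    (θ : GaloisRepresentations.HeckeCharacter E)
    (hθL : ∃ᶠ W : HeightOneSpectrum (𝓞 L) in cofinite, ∃ W' : HeightOneSpectrum (𝓞 L),
      W'.asIdeal.under (𝓞 K) = W.asIdeal.under (𝓞 K) ∧
        (θ.baseChange L).valueAtUniformizer W' ≠ (θ.baseChange L).valueAtUniformizer W)
    (hF : isCompact_glFiniteIntegralLevel 3 F) :
    ∃ π : CuspidalAutomorphicRepData 3 F hF,
      ∀ᶠ v : HeightOneSpectrum (𝓞 F) in cofinite, ∀ V : HeightOneSpectrum (𝓞 K),
        V.asIdeal.under (𝓞 F) = v.asIdeal →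
          (V.asIdeal.inertiaDeg (𝓞 F) = 1 →
            ∃ α : Multiset ℂ, π.1.HasSatakeParamAt v α ∧
              satakePolynomial α =
                ∏ᶠ w ∈ {w : HeightOneSpectrum (𝓞 E) | w.under (𝓞 F) = v},
                  (X ^ w.asIdeal.inertiaDeg (𝓞 F) - C (θ.valueAtUniformizer w))) ∧
          (V.asIdeal.inertiaDeg (𝓞 F) = 2 →
            ∃ α : Multiset ℂ, π.1.HasSatakeParamAt v α ∧
              satakePolynomial (α.map (· ^ 2)) =
                ∏ᶠ W ∈ {W : HeightOneSpectrum (𝓞 L) | W.under (𝓞 K) = V},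
                  (X ^ W.asIdeal.inertiaDeg (𝓞 K) -
                    C (θ.valueAtUniformizer (W.under (𝓞 E)) ^ W.asIdeal.inertiaDeg (𝓞 E)))) := by
  haveI : FiniteDimensional F L := Module.Finite.of_restrictScalars_finite ℚ F L
  haveI : FiniteDimensional F K := Module.Finite.of_restrictScalars_finite ℚ F K
  haveI : FiniteDimensional K L := Module.Finite.of_restrictScalars_finite ℚ K L
  have hFL : Module.finrank F L = 6 := by rw [← Module.finrank_mul_finrank F K L, hFK, hKL]
  set hK := isCompact_glFiniteIntegralLevel_holds 3 K
  obtain ⟨π, P, hBC, hPQ⟩ := exists_cuspidal_resolventDescent hAIc hD hFK hKL hEL θ hθL hF hK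
  have hθLW : ∀ᶠ W : HeightOneSpectrum (𝓞 L) in cofinite, (θ.baseChange L).valueAtUniformizer W =
      θ.valueAtUniformizer (W.under (𝓞 E)) ^ W.asIdeal.inertiaDeg (𝓞 E) :=
    θ.eventually_valueAtUniformizer_baseChange (E := L)
  have hurK : ∀ᶠ V : HeightOneSpectrum (𝓞 K) in cofinite,
      Algebra.IsUnramifiedIn (𝓞 L) V.asIdeal :=
    Filter.eventually_cofinite.2 (GaloisRepresentations.finite_setOf_not_isUnramifiedIn K L)
  have hurF : ∀ᶠ v : HeightOneSpectrum (𝓞 F) in cofinite,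
      Algebra.IsUnramifiedIn (𝓞 L) v.asIdeal :=
    Filter.eventually_cofinite.2 (GaloisRepresentations.finite_setOf_not_isUnramifiedIn F L)
  have hall := π.1.hasSatakeParamAt_cofinite_holds.and (hurF.and (eventually_forall_under_eq
    (F := F) (hBC.and (hPQ.and ((eventually_forall_under_eq (F := K) hθLW).and hurK)))))
  refine ⟨π, ?_⟩
  filter_upwards [hall] with v hv V hVv
  obtain ⟨⟨α, hα⟩, hvL, hV⟩ := hv
  obtain ⟨hBCV, ⟨β, hβ, hβQ⟩, hθV, hVu⟩ := hV V hVv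
  have hPα : P.1.HasSatakeParamAt V (α.map (· ^ V.asIdeal.inertiaDeg (𝓞 F))) := hBCV v α hVv hα
  constructor
  · intro hsplit
    refine ⟨α, hα, ?_⟩
    rw [hsplit] at hPα
    simp only [pow_one, Multiset.map_id'] at hPα
    rw [P.1.hasSatakeParamAt_unique_holds hPα hβ, hβQ]
    obtain ⟨W, hW⟩ := exists_above (E := L) V
    exact finprod_resolventSplit_eq hFL hKL hEL hVv hW hsplit hvL hVu θ hθV
  · intro hinert
    refine ⟨α, hα, ?_⟩
    rw [hinert] at hPα
    rw [P.1.hasSatakeParamAt_unique_holds hPα hβ, hβQ]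
    exact finprod_mem_congr rfl fun W hW => by
      rw [hθV W (congrArg HeightOneSpectrum.asIdeal (show W.under (𝓞 K) = V from hW))]

/-- **Non-stability of `θ ∘ N_{L/E}` over `K` from the values of `θ`**: if at infinitely many
places `v` of `F` split in `K` two places of `E` above `v` carry different values of `θ`, then
`θ_L = θ ∘ N_{L/E}` takes different values at two places of `L` above one place of `K`, for
infinitely many places of `L` — the hypothesis of `exists_cuspidal_resolventDescent`.  (Above a
split `v`, the places of `E` over `v` lift to places of `L` over one `V ∣ v`, unramified of degree
`1` over `E`, `placesOver_resolventSplit`, where `θ_L(ϖ_W) = θ(ϖ_{W ∩ E})`,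
`HeckeCharacter.eventually_valueAtUniformizer_baseChange`.) [folklore] -/
theorem frequently_baseChange_valueAtUniformizer_ne [IsGalois F L] [IsGalois E L]
    (hFL : Module.finrank F L = 6) (hKL : Module.finrank K L = 3) (hEL : Module.finrank E L = 2)
    (θ : GaloisRepresentations.HeckeCharacter E)
    (hθ : ∃ᶠ v : HeightOneSpectrum (𝓞 F) in cofinite,
      (∃ V : HeightOneSpectrum (𝓞 K), V.asIdeal.under (𝓞 F) = v.asIdeal ∧
          V.asIdeal.inertiaDeg (𝓞 F) = 1) ∧
        ∃ w w' : HeightOneSpectrum (𝓞 E), w.asIdeal.under (𝓞 F) = v.asIdeal ∧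
          w'.asIdeal.under (𝓞 F) = v.asIdeal ∧ θ.valueAtUniformizer w ≠ θ.valueAtUniformizer w') :
    ∃ᶠ W : HeightOneSpectrum (𝓞 L) in cofinite, ∃ W' : HeightOneSpectrum (𝓞 L),
      W'.asIdeal.under (𝓞 K) = W.asIdeal.under (𝓞 K) ∧
        (θ.baseChange L).valueAtUniformizer W' ≠ (θ.baseChange L).valueAtUniformizer W := by
  by_contra hcon
  rw [Filter.not_frequently] at hcon
  have hθLW : ∀ᶠ W : HeightOneSpectrum (𝓞 L) in cofinite, (θ.baseChange L).valueAtUniformizer W =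
      θ.valueAtUniformizer (W.under (𝓞 E)) ^ W.asIdeal.inertiaDeg (𝓞 E) :=
    θ.eventually_valueAtUniformizer_baseChange (E := L)
  have hurK : ∀ᶠ V : HeightOneSpectrum (𝓞 K) in cofinite,
      Algebra.IsUnramifiedIn (𝓞 L) V.asIdeal :=
    Filter.eventually_cofinite.2 (GaloisRepresentations.finite_setOf_not_isUnramifiedIn K L)
  have hurF : ∀ᶠ v : HeightOneSpectrum (𝓞 F) in cofinite,
      Algebra.IsUnramifiedIn (𝓞 L) v.asIdeal :=
    Filter.eventually_cofinite.2 (GaloisRepresentations.finite_setOf_not_isUnramifiedIn F L)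
  have h2 := hurF.and (eventually_forall_under_eq (F := F)
    ((eventually_forall_under_eq (F := K) hcon).and
      ((eventually_forall_under_eq (F := K) hθLW).and hurK)))
  obtain ⟨v, ⟨⟨V, hVv, hsplit⟩, w, w', hw, hw', hne⟩, hvL, hV⟩ := (hθ.and_eventually h2).exists
  obtain ⟨hstV, hθV, hVu⟩ := hV V hVv
  obtain ⟨W₀, hW₀⟩ := exists_above (E := L) V
  obtain ⟨-, hsurj⟩ :=
    HeightOneSpectrum.placesOver_resolventSplit hFL hKL hEL hVv hW₀ hsplit hvL hVu
  obtain ⟨W, hWV, hWw⟩ := hsurj w hw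
  obtain ⟨W', hW'V, hW'w'⟩ := hsurj w' hw'
  have hfW := (HeightOneSpectrum.inertiaDeg_of_resolventSplit (F := F) hKL hEL hWV hsplit).1
  have hfW' := (HeightOneSpectrum.inertiaDeg_of_resolventSplit (F := F) hKL hEL hW'V hsplit).1
  refine hstV W hWV ⟨W', hW'V.trans hWV.symm, ?_⟩
  rw [hθV W' hW'V, hθV W hWV, hfW, hfW', pow_one, pow_one,
    show W'.under (𝓞 E) = w' from HeightOneSpectrum.ext hW'w',
    show W.under (𝓞 E) = w from HeightOneSpectrum.ext hWw]
  exact hne.symm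

/-- **The split-place half of the fact, with the hypothesis on `θ` itself**: if at infinitely
many places `v` of `F` split in the resolvent `K` two places of `E` above `v` carry different
values of `θ` (for `E/F` non-normal: infinitely many totally split `v = w₁ w₂ w₃` with the
`θ(ϖ_{wᵢ})` not all equal), then, granting `automorphicInduction_cyclic_cuspidal` and
`cuspidal_descent_cyclic`, some cuspidal `π` on `GL₃(𝔸_F)` satisfies
`det(X - t_{π,v}) = ∏_{w ∣ v} (X^{f(w|v)} - θ(ϖ_w))` at almost every place `v` split in `K`
(`exists_cuspidal_cubic_resolventSplit` with `frequently_baseChange_valueAtUniformizer_ne`).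
[cite: ArthurClozelAMS120, Ch. 3 Thm. 6.2, Lemma 6.4 and Thm. 4.2 (d)]
[cite: Gelbart1997, Thm. 5.3.1 and Remark 5.3.1 (e)] -/
theorem exists_cuspidal_cubic_resolventSplit_of_frequently
    (hAIc : automorphicInduction_cyclic_cuspidal) (hD : cuspidal_descent_cyclic)
    [IsGalois F L] [IsGalois F K] [IsGalois E L]
    (hFK : Module.finrank F K = 2) (hKL : Module.finrank K L = 3) (hEL : Module.finrank E L = 2)
    (θ : GaloisRepresentations.HeckeCharacter E)
    (hθ : ∃ᶠ v : HeightOneSpectrum (𝓞 F) in cofinite,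
      (∃ V : HeightOneSpectrum (𝓞 K), V.asIdeal.under (𝓞 F) = v.asIdeal ∧
          V.asIdeal.inertiaDeg (𝓞 F) = 1) ∧
        ∃ w w' : HeightOneSpectrum (𝓞 E), w.asIdeal.under (𝓞 F) = v.asIdeal ∧
          w'.asIdeal.under (𝓞 F) = v.asIdeal ∧ θ.valueAtUniformizer w ≠ θ.valueAtUniformizer w')
    (hF : isCompact_glFiniteIntegralLevel 3 F) :
    ∃ π : CuspidalAutomorphicRepData 3 F hF,
      ∀ᶠ v : HeightOneSpectrum (𝓞 F) in cofinite,
        (∃ V : HeightOneSpectrum (𝓞 K), V.asIdeal.under (𝓞 F) = v.asIdeal ∧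
            V.asIdeal.inertiaDeg (𝓞 F) = 1) →
          ∃ α : Multiset ℂ, π.1.HasSatakeParamAt v α ∧
            satakePolynomial α =
              ∏ᶠ w ∈ {w : HeightOneSpectrum (𝓞 E) | w.under (𝓞 F) = v},
                (X ^ w.asIdeal.inertiaDeg (𝓞 F) - C (θ.valueAtUniformizer w)) := by
  haveI : FiniteDimensional F L := Module.Finite.of_restrictScalars_finite ℚ F L
  haveI : FiniteDimensional F K := Module.Finite.of_restrictScalars_finite ℚ F K
  haveI : FiniteDimensional K L := Module.Finite.of_restrictScalars_finite ℚ K L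
  have hFL : Module.finrank F L = 6 := by rw [← Module.finrank_mul_finrank F K L, hFK, hKL]
  exact exists_cuspidal_cubic_resolventSplit hAIc hD hFK hKL hEL θ
    (frequently_baseChange_valueAtUniformizer_ne hFL hKL hEL θ hθ) hF

end Descent

end Literature.NumberTheory.Automorphic

end
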